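import Summits.FinalStateConjecture.FinalStateConjecture.Theorems.CaptureSufficesTame.Negative.TameGenericityModel

/-!
# TAME Christodoulou genericity is not closed under conjunction — part 2: the theorem
# (negative-side support for crux `CaptureSufficesTame`, item `stmt-FinalStateConjecture-17270`,
# route `PhaseMixingCapture`, rank 6)

* `not_isTameChristodoulouGeneric_and_closed` — **the natural strengthening of the crux's transfer
  ("prove quiet / margin / third law POINTWISE tame-generically and intersect with the tame-generic
  hypothesis `h₃`, tame weak cosmic censorship") is not available as logic**: there are a class `𝓓` of
  Dafermos–Rodnianski-flat data on the Minkowski slice containing the trivial datum and properties `P`,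
  `Q`, each TAME-Christodoulou-generic in `𝓓` (codimension `1`, `IsTameChristodoulouGeneric … 1` of
  `TameGenericity.lean` — the summit's notion), whose conjunction is not
  (`isTameChristodoulouGeneric_and_fails`).

Model: the class `tameClass` and the tame, immersed, injective bumped families `famT` of part 1
(`TameGenericityModel.lean`); observable `Φ` and exceptional sets of
`TameCensorship/Negative/GenericityAndFails.lean` (origin + upper semicircles of radii `1/(n+1)`; lower
semicircles): each is escaped from every member of the class by a tame radial / parabolic family
(`radial_escapeT`, `origin_escapeT`), but every TAME curve through the trivial datum is jointly smooth, so
the intermediate value theorem on `|Φ|²` makes it meet the union at a non-zero parameter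
(`not_isTameChristodoulouGeneric_P_and_Q`, for EVERY class containing `trivialData`).

Consequence for provers of the crux (information, not a defect of the item): a closing line must carry
its dynamical genericity RELATIVELY — handed-back curves along censored / quiet curves
(`InitialDataSet.isTameChristodoulouGeneric_of_relative`), as the registered stubs of
`Theorems/PhaseMixingCaptureCaptureSufficesC2DiagonalReduction` and the crux card
`only-the-third-law-is-generic` do; a layer of pointwise tame-generic statements glued by conjunction
does not type-check as a proof of the re-typed summit. All proved; no definitions, no named facts.
-/

-- the problem namespace `FinalStateConjecture.FinalStateConjecture` (single-conjunct summit) trips dupNamespace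
set_option linter.dupNamespace false

noncomputable section

open Bundle TopologicalSpace Manifold Set Function Metric
open scoped ContDiff Topology InnerProductSpace RealInnerProductSpace

namespace Summit.FinalStateConjecture.FinalStateConjecture.Theorems.CaptureSufficesTame.Negative

open Literature.Geometry.Lorentzian
open Summit.FinalStateConjecture.FinalStateConjecture.Theorems.TameCensorship.Negative

/-! ### Tame escapes -/

/-- **Tame radial escape.** Through a member of the class whose observable lies on the `n`-th circle
passes a TAME, immersed, injective family of members of the class whose other members avoid the
origin and every circle. -/
theorem radial_escapeT {D : SliceData} (hD : D ∈ tameClass) {n : ℕ} (hn : Φ D ∈ circle n) :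
    ∃ F : EuclideanSpace ℝ (Fin 1) → SliceData,
      InitialDataSet.IsTameDataFamily (trivialAFEnd.restrict trivialAFEnd_R_lt_two.le) 1 F ∧
      InitialDataSet.IsImmersedAtZero 1 F ∧ F 0 = D ∧ Injective F ∧ (∀ c, F c ∈ tameClass) ∧
      ∀ c ≠ 0, F c ∈ goodP ∧ F c ∈ goodQ := by
  set u := (Φ D).1 with hu
  set v := (Φ D).2 with hv
  have hrad : u ^ 2 + v ^ 2 = rad n ^ 2 := hn
  have huv : u ≠ 0 ∨ v ≠ 0 := by
    by_contra h
    push Not at h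
    rw [h.1, h.2] at hrad
    have := rad_pos n
    nlinarith
  have ha : ContDiff ℝ ∞ (fun t ↦ u * θf n t) := contDiff_const.mul (contDiff_θf n)
  have hb : ContDiff ℝ ∞ (fun t ↦ v * θf n t) := contDiff_const.mul (contDiff_θf n)
  have himm : InitialDataSet.IsImmersedAtZero 1
      (famT D (fun t ↦ u * θf n t) (fun t ↦ v * θf n t)) := by
    rcases huv with hne | hne
    · exact isImmersedAtZero_famT_fst D ((hasDerivAt_θf_zero n).const_mul u)
        (mul_ne_zero hne (deriv_θf_ne_zero n))
    · exact isImmersedAtZero_famT_snd D ((hasDerivAt_θf_zero n).const_mul v)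
        (mul_ne_zero hne (deriv_θf_ne_zero n))
  refine ⟨famT D (fun t ↦ u * θf n t) (fun t ↦ v * θf n t), isTameDataFamily_famT hD ha hb, himm,
    famT_zero D _ _ (by rw [θf_zero, mul_zero]) (by rw [θf_zero, mul_zero]), ?_,
    fun c ↦ famT_mem_tameClass hD _ _ c, ?_⟩
  · intro c c' h
    have h₀ := congrArg (fun D : SliceData ↦ D.k p₀ e e) h
    have h₁ := congrArg (fun D : SliceData ↦ D.k p₁ e e) h
    simp only [famT_k_p₀, famT_k_p₁, add_right_inj] at h₀ h₁
    apply euclid1_ext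
    apply θf_injective n
    rcases huv with hne | hne
    · exact mul_left_cancel₀ hne h₀
    · exact mul_left_cancel₀ hne h₁
  · intro c hc
    have hc0 : c 0 ≠ 0 := euclid1_ne_zero hc
    have hθ0 : θf n (c 0) ≠ 0 := fun h ↦ hc0 ((θf_eq_zero_iff n _).1 h)
    have hpos := one_add_θf_pos n (c 0)
    have hΦ : Φ (famT D (fun t ↦ u * θf n t) (fun t ↦ v * θf n t) c) =
        (u * (1 + θf n (c 0)), v * (1 + θf n (c 0))) := by
      rw [Φ_famT, ← hu, ← hv]; ext <;> ring
    -- not the origin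
    have hne : Φ (famT D (fun t ↦ u * θf n t) (fun t ↦ v * θf n t) c) ≠ 0 := by
      rw [hΦ]
      intro h
      have h1 : u * (1 + θf n (c 0)) = 0 := congrArg Prod.fst h
      have h2 : v * (1 + θf n (c 0)) = 0 := congrArg Prod.snd h
      rcases huv with hne | hne
      · exact hne (by simpa [hpos.ne'] using h1)
      · exact hne (by simpa [hpos.ne'] using h2)
    -- on no circle
    have hnc : ∀ m, Φ (famT D (fun t ↦ u * θf n t) (fun t ↦ v * θf n t) c) ∉ circle m := by
      intro m hm
      rw [hΦ, mem_circle] at hm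
      simp only at hm
      have hsq : ((1 + θf n (c 0)) * rad n) ^ 2 = rad m ^ 2 := by
        rw [← hm, mul_pow, ← hrad]; ring
      have heq : (1 + θf n (c 0)) * rad n = rad m :=
        (sq_eq_sq₀ (mul_nonneg hpos.le (rad_pos n).le) (rad_pos m).le).1 hsq
      apply no_circle_rescale (m := m) (abs_θf_lt n (c 0)) hθ0
      unfold rad at heq
      field_simp at heq
      linarith
    exact ⟨fun h ↦ h.elim hne fun ⟨m, hm, _⟩ ↦ hnc m hm, fun ⟨m, hm, _⟩ ↦ hnc m hm⟩

/-- **Tame escape from the origin along the parabola `(t, -t²)`**, which meets no upper semicircle. -/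
theorem origin_escapeT {D : SliceData} (hD : D ∈ tameClass) (h0 : Φ D = 0) :
    ∃ F : EuclideanSpace ℝ (Fin 1) → SliceData,
      InitialDataSet.IsTameDataFamily (trivialAFEnd.restrict trivialAFEnd_R_lt_two.le) 1 F ∧
      InitialDataSet.IsImmersedAtZero 1 F ∧ F 0 = D ∧ Injective F ∧ (∀ c, F c ∈ tameClass) ∧
      ∀ c ≠ 0, F c ∈ goodP := by
  refine ⟨famT D (fun t ↦ t) (fun t ↦ -(t * t)),
    isTameDataFamily_famT hD contDiff_id (contDiff_id.mul contDiff_id).neg,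
    isImmersedAtZero_famT_fst D (hasDerivAt_id (0 : ℝ)) one_ne_zero,
    famT_zero D _ _ rfl (by norm_num), ?_, fun c ↦ famT_mem_tameClass hD _ _ c, ?_⟩
  · intro c c' h
    have h₀ := congrArg (fun D : SliceData ↦ D.k p₀ e e) h
    simp only [famT_k_p₀, add_right_inj] at h₀
    exact euclid1_ext h₀
  · intro c hc
    have hc0 : c 0 ≠ 0 := euclid1_ne_zero hc
    have hΦ : Φ (famT D (fun t ↦ t) (fun t ↦ -(t * t)) c) = (c 0, -(c 0 * c 0)) := by
      rw [Φ_famT, h0]; simp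
    intro hA
    rw [hΦ] at hA
    rcases hA with h | ⟨m, -, hm⟩
    · exact hc0 (congrArg Prod.fst h)
    · simp only at hm
      have : 0 < c 0 * c 0 := mul_self_pos.2 hc0
      linarith

/-! ### Each property is tame-generic; the conjunction is not -/

/-- `P` is TAME-Christodoulou-generic (codimension `1`) in the class. -/
theorem isTameChristodoulouGeneric_P :
    InitialDataSet.IsTameChristodoulouGeneric tameClass (· ∈ goodP) 1 := by
  rintro D ⟨hD, hP⟩
  simp only [mem_goodP, not_not] at hP
  rcases hP with h0 | ⟨n, hn, -⟩
  · obtain ⟨F, hF, himm, h0', hinj, hcl, hgood⟩ := origin_escapeT hD h0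
    exact ⟨_, F, hF, himm, h0', hinj, hcl, fun c hc hmem ↦ hmem.2 (hgood c hc)⟩
  · obtain ⟨F, hF, himm, h0', hinj, hcl, hgood⟩ := radial_escapeT hD hn
    exact ⟨_, F, hF, himm, h0', hinj, hcl, fun c hc hmem ↦ hmem.2 (hgood c hc).1⟩

/-- `Q` is TAME-Christodoulou-generic (codimension `1`) in the class. -/
theorem isTameChristodoulouGeneric_Q :
    InitialDataSet.IsTameChristodoulouGeneric tameClass (· ∈ goodQ) 1 := by
  rintro D ⟨hD, hQ⟩
  simp only [mem_goodQ, not_not] at hQ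
  obtain ⟨n, hn, -⟩ := hQ
  obtain ⟨F, hF, himm, h0', hinj, hcl, hgood⟩ := radial_escapeT hD hn
  exact ⟨_, F, hF, himm, h0', hinj, hcl, fun c hc hmem ↦ hmem.2 (hgood c hc).2⟩

/-- **The trap, tame form.** In ANY class containing the trivial datum, `P ∧ Q` is not
tame-Christodoulou-generic: a tame witness curve is jointly smooth, and every jointly smooth curve
through the trivial datum (observable at the origin) meets a circle at a non-zero parameter
(intermediate value theorem on the squared radius of the observable). -/
theorem not_isTameChristodoulouGeneric_P_and_Q {𝓓 : Set SliceData} (h𝓓 : trivialData ∈ 𝓓) :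
    ¬ InitialDataSet.IsTameChristodoulouGeneric 𝓓 (fun D ↦ D ∈ goodP ∧ D ∈ goodQ) 1 := by
  intro hgen
  have hex : trivialData ∈ {d ∈ 𝓓 | ¬ (d ∈ goodP ∧ d ∈ goodQ)} :=
    ⟨h𝓓, fun h ↦ h.1 (Or.inl Φ_trivialData)⟩
  obtain ⟨e', F, hFt, -, hF0, -, hFD, hexc⟩ := hgen trivialData hex
  have hF : InitialDataSet.IsSmoothDataFamily 1 F := hFt.1
  -- the good members avoid `A ∪ B`
  have hgood : ∀ c ≠ 0, Φ (F c) ∉ setA ∧ Φ (F c) ∉ setB := fun c hc ↦ by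
    have h := hexc c hc
    by_contra hn
    exact h ⟨hFD c, hn⟩
  -- the straight parameter curve `t ↦ t e₁`
  set e₁ : EuclideanSpace ℝ (Fin 1) := EuclideanSpace.single 0 1 with he₁
  set ι : ℝ → EuclideanSpace ℝ (Fin 1) := fun t ↦ t • e₁ with hι
  have hι0 : ∀ t, ι t 0 = t := fun t ↦ by simp [hι, he₁]
  have hιne : ∀ t ≠ 0, ι t ≠ 0 := fun t ht h ↦ ht (by rw [← hι0 t, h]; rfl)
  have hιz : ι 0 = 0 := by simp [hι]
  have hιs : ContMDiff 𝓘(ℝ, ℝ) 𝓘(ℝ, EuclideanSpace ℝ (Fin 1)) ∞ ι :=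
    (contDiff_id.smul contDiff_const).contMDiff
  -- squared radius of the observable along the curve
  set f : ℝ → ℝ := fun t ↦ ((F (ι t)).k p₀ e e) ^ 2 + ((F (ι t)).k p₁ e e) ^ 2 with hf
  have hfc : Continuous f :=
    ((continuous_k_apply hF hιs p₀ e e).pow 2).add ((continuous_k_apply hF hιs p₁ e e).pow 2)
  have hf0 : f 0 = 0 := by
    simp only [hf, hιz, hF0]
    simp
  have hf1 : 0 < f 1 := by
    have hA := (hgood (ι 1) (hιne 1 one_ne_zero)).1
    have hne : Φ (F (ι 1)) ≠ 0 := fun h ↦ hA (Or.inl h)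
    have : (Φ (F (ι 1))).1 ≠ 0 ∨ (Φ (F (ι 1))).2 ≠ 0 := by
      by_contra h
      push Not at h
      exact hne (Prod.ext h.1 h.2)
    simp only [hf, Φ] at this ⊢
    rcases this with h | h
    · positivity
    · positivity
  obtain ⟨n, hn⟩ := exists_nat_one_div_lt hf1
  have hn' : rad n ^ 2 ≤ f 1 := by
    have h1 : rad n ^ 2 ≤ rad n := by
      rw [sq]; exact mul_le_of_le_one_left (rad_pos n).le (rad_le_one n)
    exact h1.trans (le_of_lt hn)
  obtain ⟨t, ht, hft⟩ :=
    intermediate_value_Icc zero_le_one hfc.continuousOn ⟨by rw [hf0]; positivity, hn'⟩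
  have ht0 : t ≠ 0 := by
    rintro rfl
    rw [hf0] at hft
    exact (pow_pos (rad_pos n) 2).ne hft
  have hcirc : Φ (F (ι t)) ∈ circle n := hft
  rcases le_or_gt 0 (Φ (F (ι t))).2 with h | h
  · exact (hgood (ι t) (hιne t ht0)).1 (Or.inr ⟨n, hcirc, h⟩)
  · exact (hgood (ι t) (hιne t ht0)).2 ⟨n, hcirc, h⟩

/-- **TAME Christodoulou genericity (`IsTameChristodoulouGeneric … 1`) is not closed under
conjunction**: on the data space of the Minkowski slice there are a class `𝓓 ∋ trivialData` of
Dafermos–Rodnianski-flat data and properties `P`, `Q`, each tame-generic in `𝓓`, whose conjunction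
is not. -/
theorem isTameChristodoulouGeneric_and_fails :
    ∃ (𝓓 : Set SliceData) (P Q : SliceData → Prop), trivialData ∈ 𝓓 ∧
      InitialDataSet.IsTameChristodoulouGeneric 𝓓 P 1 ∧
      InitialDataSet.IsTameChristodoulouGeneric 𝓓 Q 1 ∧
      ¬ InitialDataSet.IsTameChristodoulouGeneric 𝓓 (fun D ↦ P D ∧ Q D) 1 :=
  ⟨tameClass, (· ∈ goodP), (· ∈ goodQ), trivialData_mem_tameClass, isTameChristodoulouGeneric_P,
    isTameChristodoulouGeneric_Q, not_isTameChristodoulouGeneric_P_and_Q trivialData_mem_tameClass⟩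

/-- **The glue lemma is false for the summit's TAME notion.** Tame-Christodoulou-genericity
(codimension `1`) of two properties does not imply that of their conjunction — already on the
Minkowski slice, on a class of Dafermos–Rodnianski-flat data of mass `0`. Hence a proof of the
re-typed summit from a tame-generic HYPOTHESIS (the crux's `h₃`, tame weak cosmic censorship) must
compose along curves (`InitialDataSet.isTameChristodoulouGeneric_of_relative`), not intersect. -/
theorem not_isTameChristodoulouGeneric_and_closed :
    ¬ ∀ (𝓓 : Set SliceData) (P Q : SliceData → Prop),
      InitialDataSet.IsTameChristodoulouGeneric 𝓓 P 1 →
        InitialDataSet.IsTameChristodoulouGeneric 𝓓 Q 1 →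
          InitialDataSet.IsTameChristodoulouGeneric 𝓓 (fun D ↦ P D ∧ Q D) 1 :=
  fun h ↦ not_isTameChristodoulouGeneric_P_and_Q trivialData_mem_tameClass
    (h _ _ _ isTameChristodoulouGeneric_P isTameChristodoulouGeneric_Q)

end Summit.FinalStateConjecture.FinalStateConjecture.Theorems.CaptureSufficesTame.Negative

end
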